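import Mathlib
import Summits.NavierStokesRegularity.NavierStokesRegularity.Theses.TransitMassLedger
import Summits.NavierStokesRegularity.NavierStokesRegularity.Theorems.TransitMassLedgerLedgerRigidityEnergy
import Summits.NavierStokesRegularity.NavierStokesRegularity.Theorems.TransitMassLedgerLedgerRigidityLedger
import Summits.NavierStokesRegularity.NavierStokesRegularity.Theorems.TransitMassLedgerLedgerRigidityWindows
import HarnessLib

/-!
# `TransitMassLedger.LedgerRigidity` (item stmt-NavierStokesRegularity-24398) — PROVED

**Statement (route TransitMassLedger, crux #2).**  For every `R ≥ 1`, every table `α ∈ E₂(R)` and every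
outflow-coercive mass certificate `(ℓ, θ, κ)` of `α` on the unit ball
(`κ‖A x − A y‖² ≤ ⟪ℓ, Q x + A x + B(y,x)⟫ + θ x − θ y` for `‖x‖, ‖y‖ ≤ 1`; `κ > 0`, `θ` continuous,
`θ 0 = 0`), every solution `V : ℤ → ℝ → ℝ⁴` of the `λ = 1` lattice `V_n' = Q V_n + A V_(n−1) + B(V_(n+1),V_n)`
with `‖V_n(s)‖ ≤ 1` that is non-evanescent, square-summable at each time, drains below every shell as
`s → +∞`, vanishes above every shell as `s → −∞` and has uniformly bounded time-action `∫‖V_n‖ ≤ M`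
is identically zero (in fact these hypotheses are contradictory, which is what is proved).

**Proof (time-integrated windowed ledger; no travelling-wave or hop structure is used; helper files
`…LedgerRigidityEnergy`, `…LedgerRigidityLedger`, `…LedgerRigidityWindows`).**
Write `C_A = shiftConst α (0,0,1)`, `C_Q = shiftConst α (0,0,0)`, `E = Σ_n ‖V_n(s)‖²` (constant in `s`
by energy conservation, file `…Energy`; `E ≥ c² > 0` by non-evanescence) and `T_n(s)` for the energy
strictly above shell `n` (`T_n → E` as `s → +∞` by the drain hypothesis, `T_n → 0` as `s → −∞`).
1. UPPER BOUND (files `…Ledger`, `…Windows`; FTC): for every window of `w` consecutive shells and every time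
   interval, `∫ Σ_(i<w) κ‖A V_(a+i) − A V_(a+i+1)‖² ≤ 2‖ℓ‖√(wE) + 2‖ℓ‖C_A M + 2‖ℓ‖(C_Q+C_A) M` — the
   certificate summed over the window is the time derivative of the windowed ledger `Σ⟪ℓ,V_(a+i)⟫`
   (`|·| ≤ ‖ℓ‖√(wE)` by Cauchy–Schwarz) up to two boundary outflow terms and two boundary `θ` terms,
   each of time integral `O(M)` because `|⟪ℓ,A x⟫|, |θ x| = O(‖x‖²) = O(‖x‖)` on the unit ball.
2. FLUX FLOOR: `∫_(s₁)^(s₂) ‖A V_n‖ ≥ ∫ ⟪V_(n+1), A V_n⟫ = ½(T_n(s₂) − T_n(s₁)) ≥ 3E/8` once `s₂` is late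
   and `s₁` early enough for the window (the energy `E` must cross every bond).
3. LOCAL COERCIVITY: with `C_A E ≤ rη`, among the `r` shells above `n` one has energy `≤ E/r`, hence
   outflow `≤ η`, so `(‖A V_n‖ − η)₊² ≤ r Σ_(j<r) ‖A V_(n+j) − A V_(n+j+1)‖²` (telescoping, Cauchy–Schwarz).
4. SLOW SEEPAGE COSTS ACTION: pointwise `(‖A V_n‖ − η)₊² ≥ η(‖A V_n‖ − √(2ηC_A)‖V_n‖)`, so
   `∫(‖A V_n‖ − η)₊² ≥ η(3E/8 − √(2ηC_A) M) ≥ ηE/4` for `η = E²/(128(C_A M² + 1))`.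
5. Summing 3–4 over a window of `w` shells and comparing with 1 (window `w + r`):
   `κ w ηE/4 ≤ r²(2‖ℓ‖√((w+r)E) + O(M))` — linear in `w` against `√w`, absurd for `w` large.

HONEST FRAMING: a theorem about a MODEL lattice ODE (the `λ = 1` limit lattice of Tao 2016 §4 for a
cancelling comparable table); nothing here bears on Navier–Stokes regularity or the Clay problem.  Only
the cancellation identities of `InTableClass` are used (symmetry and comparability are not needed).
-/

noncomputable section

set_option linter.dupNamespace false

namespace Summit.NavierStokesRegularity.NavierStokesRegularity.Theorems

namespace TransitMassLedgerLedgerRigidity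

open MeasureTheory Filter Topology Finset intervalIntegral
open scoped RealInnerProductSpace
open Literature.Analysis.FluidPDE Literature.Analysis.FluidPDE.TaoCascade
open TransitMassLedgerEnergy TransitMassLedgerLedger TransitMassLedgerWindows

variable {m : ℕ} {α : Fin m → Fin m → Fin m → ℤ × ℤ × ℤ → ℝ} {ℓ : Em m} {θ : Em m → ℝ} {κ : ℝ}
  {V : ℤ → ℝ → Em m}

/-! ## Step 5: assembly — the hypotheses of `LedgerRigidity` are contradictory -/

/-- **No normalised complete transit of finite action on a certified table** (any number of modes `m`):
under an outflow-coercive mass certificate, the `λ = 1` lattice of a cancelling table carries no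
solution of the unit ball that is non-evanescent, square-summable at each time, draining below every
shell as `s → +∞`, vanishing above every shell as `s → −∞`, with uniformly bounded time-action.
(Steps 1–5 of the module docstring.)
[cite: Tao2016AveragedNS, §4 (4.1)–(4.3), Lemma 4.1 (4.8)–(4.9); route TransitMassLedger (crux LedgerRigidity); this file] -/
theorem no_certified_transit (hc : IsCancellingCoeff α)
    (hcert : ∀ x y : Em m, ‖x‖ ≤ 1 → ‖y‖ ≤ 1 →
      κ * ‖tableA α x - tableA α y‖ ^ 2 ≤ ⟪ℓ, tableQ α x + tableA α x + tableB α y x⟫ + θ x - θ y)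
    (hκ : 0 < κ) (hθc : Continuous θ) (hθ0 : θ 0 = 0)
    (hl : ∀ (n : ℤ) (s : ℝ), HasDerivAt (V n)
      (tableQ α (V n s) + tableA α (V (n - 1) s) + tableB α (V (n + 1) s) (V n s)) s)
    (hb : ∀ (n : ℤ) (s : ℝ), ‖V n s‖ ≤ 1) (hne : ∃ c : ℝ, 0 < c ∧ ∀ s : ℝ, ∃ n : ℤ, c ≤ ‖V n s‖)
    (hs : ∀ s : ℝ, Summable fun n : ℤ => ‖V n s‖ ^ 2)
    (hf : ∀ N : ℤ, Tendsto (fun s : ℝ => ∑' k : ℕ, ‖V (N - (k : ℤ)) s‖ ^ 2) atTop (𝓝 0))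
    (hbk : ∀ N : ℤ, Tendsto (fun s : ℝ => ∑' k : ℕ, ‖V (N + (k : ℤ)) s‖ ^ 2) atBot (𝓝 0))
    (hact : ∃ M : ℝ, ∀ n : ℤ, Integrable (fun s => ‖V n s‖) ∧ ∫ s, ‖V n s‖ ≤ M) : False := by
  obtain ⟨c, hc0, hcs⟩ := hne
  obtain ⟨M, hM⟩ := hact
  have hCA := shiftConst_nonneg α (0, 0, 1)
  have hCQ := shiftConst_nonneg α (0, 0, 0)
  have hV := continuous_shell hl
  have hA := continuous_tableA α
  -- total energy, conserved and positive
  set E := ∑' j : ℤ, ‖V j 0‖ ^ 2 with hE_def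
  have hEs : ∀ s, ∑' j : ℤ, ‖V j s‖ ^ 2 = E := fun s => energy_conserved hc hl hb hs 0 s
  have hEpos : 0 < E := by
    obtain ⟨n₀, hn₀⟩ := hcs 0
    have h1 : ‖V n₀ 0‖ ^ 2 ≤ E := shell_le_tsum hs n₀ 0
    have h2 : c ^ 2 ≤ ‖V n₀ 0‖ ^ 2 := pow_le_pow_left₀ hc0.le hn₀ 2
    have h3 : 0 < c ^ 2 := by positivity
    linarith
  have hM0 : 0 ≤ M := le_trans (integral_nonneg fun s => norm_nonneg _) (hM 0).2
  -- the tails `T_n(s) = Σ_k ‖V_(n+1+k)(s)‖²`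
  have hsplit : ∀ (n : ℤ) (s : ℝ),
      E = (∑' k : ℕ, ‖V (n - k) s‖ ^ 2) + ∑' k : ℕ, ‖V (n + 1 + k) s‖ ^ 2 :=
    fun n s => (hEs s).symm.trans (tsum_int_eq_tails hs n s)
  have hTtop : ∀ n : ℤ, Tendsto (fun s => ∑' k : ℕ, ‖V (n + 1 + k) s‖ ^ 2) atTop (𝓝 E) := by
    intro n
    have h := (hf n).const_sub E
    rw [sub_zero] at h
    refine h.congr' (Eventually.of_forall fun s => ?_)
    have := hsplit n s
    linarith
  have hTbot : ∀ n : ℤ, Tendsto (fun s => ∑' k : ℕ, ‖V (n + 1 + k) s‖ ^ 2) atBot (𝓝 0) :=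
    fun n => hbk (n + 1)
  have hTmono : ∀ {n n' : ℤ}, n ≤ n' → ∀ s : ℝ,
      ∑' k : ℕ, ‖V (n' + 1 + k) s‖ ^ 2 ≤ ∑' k : ℕ, ‖V (n + 1 + k) s‖ ^ 2 := by
    intro n n' hnn' s
    obtain ⟨d, rfl⟩ := Int.le.dest hnn'
    exact tailAbove_add_le hs n d s
  have hflux : ∀ (n : ℤ) (s₁ s₂ : ℝ),
      (∑' k : ℕ, ‖V (n + 1 + k) s₂‖ ^ 2) - (∑' k : ℕ, ‖V (n + 1 + k) s₁‖ ^ 2) =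
        2 * ∫ s in s₁..s₂, ⟪V (n + 1) s, tableA α (V n s)⟫ :=
    tailAbove_sub hc hl hb hs
  have hwin : ∀ (a : ℤ) (N : ℕ) (s : ℝ), ∑ i ∈ range N, ‖V (a + i) s‖ ^ 2 ≤ E :=
    fun a N s => (window_energy_le hs a N s).trans (hEs s).le
  -- the seepage level η and the block length r
  set CA := shiftConst α (0, 0, 1) with hCA_def
  set CQ := shiftConst α (0, 0, 0) with hCQ_def
  set η := E ^ 2 / (128 * (CA * M ^ 2 + 1)) with hη_def
  have hden : 0 < CA * M ^ 2 + 1 := by positivity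
  have hη0 : 0 < η := by positivity
  have hηM : Real.sqrt (2 * η * CA) * M ≤ E / 8 := by
    have h1 : 2 * η * CA * M ^ 2 ≤ (E / 8) ^ 2 := by
      have e : 2 * η * CA * M ^ 2 = (E / 8) ^ 2 * (CA * M ^ 2 / (CA * M ^ 2 + 1)) := by
        rw [hη_def]; field_simp; ring
      rw [e]
      have h2 : CA * M ^ 2 / (CA * M ^ 2 + 1) ≤ 1 := by
        rw [div_le_one hden]; linarith
      have h3 : 0 ≤ (E / 8) ^ 2 := sq_nonneg _
      nlinarith
    calc Real.sqrt (2 * η * CA) * M = Real.sqrt (2 * η * CA) * Real.sqrt (M ^ 2) := by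
          rw [Real.sqrt_sq hM0]
      _ = Real.sqrt (2 * η * CA * M ^ 2) := by rw [← Real.sqrt_mul (by positivity)]
      _ ≤ Real.sqrt ((E / 8) ^ 2) := Real.sqrt_le_sqrt h1
      _ = E / 8 := Real.sqrt_sq (by positivity)
  obtain ⟨r₀, hr₀⟩ := exists_nat_ge (CA * E / η)
  have hr : 0 < r₀ + 1 := Nat.succ_pos _
  have hrη : CA * E ≤ ((r₀ + 1 : ℕ) : ℝ) * η := by
    have h1 : CA * E ≤ r₀ * η := (div_le_iff₀ hη0).1 hr₀
    push_cast
    nlinarith [hη0.le]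
  set r : ℕ := r₀ + 1 with hr_def
  -- the key inequality, for every window length w (window = shells 0, …, w−1)
  set K₀ := 2 * (‖ℓ‖ * CA * M) + 2 * (‖ℓ‖ * (CQ + CA) * M) with hK₀_def
  have hK₀ : 0 ≤ K₀ := by positivity
  have key : ∀ w : ℕ,
      κ * (w * (η * (E / 4))) ≤ (r : ℝ) * r * (2 * (‖ℓ‖ * Real.sqrt (((w + r : ℕ) : ℝ) * E)) + K₀) := by
    intro w
    -- a late time s₂ and an early time s₁ ≤ s₂ for this window
    obtain ⟨s₂, hs₂⟩ : ∃ s₂ : ℝ, 7 * E / 8 < ∑' k : ℕ, ‖V ((w : ℤ) + 1 + k) s₂‖ ^ 2 :=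
      ((hTtop w).eventually (lt_mem_nhds (by linarith))).exists
    obtain ⟨s₁, hs₁, h12⟩ : ∃ s₁ : ℝ, (∑' k : ℕ, ‖V ((0 : ℤ) + 1 + k) s₁‖ ^ 2) < E / 8 ∧ s₁ ≤ s₂ :=
      (((hTbot 0).eventually (gt_mem_nhds (by linarith))).and (eventually_le_atBot s₂)).exists
    -- Step 2: every shell of the window passes at least 3E/8 of flux during [s₁, s₂]
    have hflux_i : ∀ i ∈ range w,
        3 * E / 8 ≤ ∫ s in s₁..s₂, ⟪V ((0 : ℤ) + i + 1) s, tableA α (V ((0 : ℤ) + i) s)⟫ := by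
      intro i hi
      have hiw := Finset.mem_range.1 hi
      have hi1 : (0 : ℤ) + i ≤ w := by omega
      have hi2 : (0 : ℤ) ≤ 0 + i := by omega
      have h1 := hflux ((0 : ℤ) + i) s₁ s₂
      have h2 := lt_of_lt_of_le hs₂ (hTmono hi1 s₂)
      have h3 := lt_of_le_of_lt (hTmono hi2 s₁) hs₁
      linarith
    -- Step 4: per-shell floor
    have hfloor_i : ∀ i ∈ range w,
        η * (E / 4) ≤ ∫ s in s₁..s₂, (max (‖tableA α (V ((0 : ℤ) + i) s)‖ - η) 0) ^ 2 := by
      intro i hi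
      have h1 := shell_floor hl hb hM ((0 : ℤ) + i) hη0.le h12
      have h2 := hflux_i i hi
      have h3 : η * (E / 4) ≤ η * ((∫ s in s₁..s₂, ⟪V ((0 : ℤ) + i + 1) s, tableA α (V ((0 : ℤ) + i) s)⟫)
          - Real.sqrt (2 * η * CA) * M) :=
        mul_le_mul_of_nonneg_left (by linarith) hη0.le
      exact h3.trans h1
    -- sum over the window
    have hmaxc : ∀ i : ℕ, Continuous fun s => (max (‖tableA α (V ((0 : ℤ) + i) s)‖ - η) 0) ^ 2 :=
      fun i => (((hA.comp (hV _)).norm.sub continuous_const).max continuous_const).pow 2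
    have hsum_floor : (w : ℝ) * (η * (E / 4)) ≤
        ∫ s in s₁..s₂, ∑ i ∈ range w, (max (‖tableA α (V ((0 : ℤ) + i) s)‖ - η) 0) ^ 2 := by
      rw [intervalIntegral.integral_finsetSum fun i _ => (hmaxc i).intervalIntegrable _ _]
      have h := Finset.sum_le_sum hfloor_i
      rw [Finset.sum_const, Finset.card_range, nsmul_eq_mul] at h
      exact h
    -- Step 3: coercivity, pointwise in time, then integrated
    have hcoer : ∀ s, κ * ∑ i ∈ range w, (max (‖tableA α (V ((0 : ℤ) + i) s)‖ - η) 0) ^ 2 ≤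
        (r : ℝ) * r * ∑ i ∈ range (w + r),
          κ * ‖tableA α (V ((0 : ℤ) + i) s) - tableA α (V ((0 : ℤ) + i + 1) s)‖ ^ 2 := by
      intro s
      have h := coercive_window_pointwise (α := α) (V := V) 0 w hr s
        (fun n => (hwin (n + 1) r s)) hrη
      rw [← Finset.mul_sum]
      have h0 : 0 ≤ ∑ i ∈ range (w + r),
          ‖tableA α (V ((0 : ℤ) + i) s) - tableA α (V ((0 : ℤ) + i + 1) s)‖ ^ 2 :=
        Finset.sum_nonneg fun _ _ => sq_nonneg _
      nlinarith [hκ.le]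
    have hDc : Continuous fun s => ∑ i ∈ range (w + r),
        κ * ‖tableA α (V ((0 : ℤ) + i) s) - tableA α (V ((0 : ℤ) + i + 1) s)‖ ^ 2 :=
      continuous_finsetSum _ fun i _ =>
        continuous_const.mul (((hA.comp (hV _)).sub (hA.comp (hV _))).norm.pow 2)
    have hint : κ * ∫ s in s₁..s₂, ∑ i ∈ range w, (max (‖tableA α (V ((0 : ℤ) + i) s)‖ - η) 0) ^ 2 ≤
        (r : ℝ) * r * ∫ s in s₁..s₂, ∑ i ∈ range (w + r),
          κ * ‖tableA α (V ((0 : ℤ) + i) s) - tableA α (V ((0 : ℤ) + i + 1) s)‖ ^ 2 := by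
      rw [← intervalIntegral.integral_const_mul, ← intervalIntegral.integral_const_mul]
      exact intervalIntegral.integral_mono_on h12
        (((continuous_finsetSum _ fun i _ => hmaxc i).const_mul κ).intervalIntegrable _ _)
        ((hDc.const_mul _).intervalIntegrable _ _) fun s _ => hcoer s
    -- Step 1 on the window of length w + r
    have hupper := window_integral hcert hκ.le hθc hθ0 hl hb hM 0 (w + r) (hwin 0 (w + r)) h12
    have hrr : (0 : ℝ) ≤ (r : ℝ) * r := by positivity
    have h5 := mul_le_mul_of_nonneg_left hupper hrr
    have h6 := mul_le_mul_of_nonneg_left hsum_floor hκ.le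
    simp only [hK₀_def]
    push_cast at h5 ⊢
    linarith
  -- Step 5: linear against square root
  refine false_of_linear_le_sqrt (c₀ := κ * (η * (E / 4))) (C₁ := (r : ℝ) * r * (2 * (‖ℓ‖ * Real.sqrt E)))
    (C₂ := (r : ℝ) * r * K₀) (by positivity) (by positivity) (by positivity) r fun w => ?_
  have h := key w
  have e : Real.sqrt (((w + r : ℕ) : ℝ) * E) = Real.sqrt ((w : ℝ) + r) * Real.sqrt E := by
    rw [Real.sqrt_mul (Nat.cast_nonneg _)]; push_cast; rfl
  rw [e] at h
  linarith

end TransitMassLedgerLedgerRigidity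

/-- **Item stmt-NavierStokesRegularity-24398** (`TransitMassLedger.LedgerRigidity`, crux #2 of route
TransitMassLedger; MODEL lattice ODEs only): on every table `α ∈ E₂(R)` carrying an outflow-coercive
mass certificate, every normalised, non-evanescent, square-summable, completely draining,
action-bounded solution of the `λ = 1` limit lattice is identically zero — indeed no such solution
exists (`TransitMassLedgerLedgerRigidity.no_certified_transit`).  Nothing here bears on Navier–Stokes
regularity. [this file] -/
theorem transitMassLedger_ledgerRigidity_proof :
    Summit.NavierStokesRegularity.NavierStokesRegularity.Theses.TransitMassLedger.LedgerRigidity := by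
  intro R hR α hα ℓ θ κ hκ hθc hθ0 hcert V hl hb hne hs hf hbk hact n s
  exact (TransitMassLedgerLedgerRigidity.no_certified_transit hα.2.1 hcert hκ hθc hθ0 hl hb hne hs
    hf hbk hact).elim

end Summit.NavierStokesRegularity.NavierStokesRegularity.Theorems

end
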